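import Summits.Ventures.PackingBounds.Energy.FivePointRieszEightXData1
import Summits.Ventures.PackingBounds.Energy.FivePointRieszEightXData2
import Summits.Ventures.PackingBounds.Energy.FivePointRieszEightXData3
import Summits.Ventures.PackingBounds.Energy.FivePointRieszEightXData4
import Summits.Ventures.PackingBounds.Energy.FivePointRieszEightXData5
import Summits.Ventures.PackingBounds.Energy.FivePointRieszEightXData6
import Summits.Ventures.PackingBounds.Energy.FivePointRieszEightXData7
import HarnessLib

/-!
# Integer congruence data `X = P (S·Y) Pᵀ` (rows of X: the table (collector of 7 part modules)) for the SOS block of `e3pt-sharp-n3N5s8d8-none.json`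
# (triangular bipyramid; five points on S², single SOS term, d = 8)

Framing: lottery ticket; floor = certified bounds/negative ranges. Venture `PackingBounds`, cell `pub-packcert`, energy family E3PT
(pub-packcert-energy gen 15; n = 3 kernel route). `bR8` = P scaled to integers (`128`·P; rows = the 165 monomials of degree ≤ 8 in
(u,v,t), columns = the 158 face-basis vectors), `xR8` = bR8 · yR8 · bR8ᵀ (165 × 165, exact integers), `scaleXR8` = 128² · S.
Checked by `decide +kernel` with `GramData.checkCongr` in `FivePointRieszEightCongrFacts*`; the slack polynomial of the certificate is
`(1/scaleXR8) · mᵀ xR8 m` for the monomial vector `m` (`FivePointRieszEightSOS`). Generator `pub-packcert-energy/code/e3pt/g17/e3pt_lean_n3x.py`.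
-/

namespace Summit.Ventures.PackingBounds.Energy.RieszEightD8

/-- The scale `128² · S` of `xR8` relative to the certificate's real Gram data. -/
def scaleXR8 : ℤ := 41344307580894023310800014802959837691904

/-- data rows. -/
def xR8 : List (List ℤ) := [xR80, xR81, xR82, xR83, xR84, xR85, xR86, xR87, xR88, xR89, xR810, xR811, xR812, xR813, xR814, xR815, xR816, xR817, xR818, xR819, xR820, xR821, xR822, xR823, xR824, xR825, xR826, xR827, xR828, xR829, xR830, xR831, xR832, xR833, xR834, xR835, xR836, xR837, xR838, xR839, xR840, xR841, xR842, xR843, xR844, xR845, xR846, xR847, xR848, xR849, xR850, xR851, xR852, xR853, xR854, xR855, xR856, xR857, xR858, xR859, xR860, xR861, xR862, xR863, xR864, xR865, xR866, xR867, xR868, xR869, xR870, xR871, xR872, xR873, xR874, xR875, xR876, xR877, xR878, xR879, xR880, xR881, xR882, xR883, xR884, xR885, xR886, xR887, xR888, xR889, xR890, xR891, xR892, xR893, xR894, xR895, xR896, xR897, xR898, xR899, xR8100, xR8101, xR8102, xR8103, xR8104, xR8105, xR8106, xR8107, xR8108, xR8109, xR8110, xR8111, xR8112, xR8113, xR8114,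 xR8115, xR8116, xR8117, xR8118, xR8119, xR8120, xR8121, xR8122, xR8123, xR8124, xR8125, xR8126, xR8127, xR8128, xR8129, xR8130, xR8131, xR8132, xR8133, xR8134, xR8135, xR8136, xR8137, xR8138, xR8139, xR8140, xR8141, xR8142, xR8143, xR8144, xR8145, xR8146, xR8147, xR8148, xR8149, xR8150, xR8151, xR8152, xR8153, xR8154, xR8155, xR8156, xR8157, xR8158, xR8159, xR8160, xR8161, xR8162, xR8163, xR8164]

end Summit.Ventures.PackingBounds.Energy.RieszEightD8
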